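import Literature.Analysis.SingularIntegrals.HardyLittlewoodMaximal
import Literature.Analysis.FunctionSpaces.SobolevTracePoincareProofs
import HarnessLib

/-!
# The pointwise maximal-function estimate `|u(x) - u(y)| ≲ |x - y| (M|Du|(x) + M|Du|(y))`
and the Lipschitz property of `C¹` functions on the sublevel sets of `M|Du|`

For a `C¹` map `u` on a finite-dimensional real normed space `E` (dimension `n`, additive
Haar measure `μ`) let `M = M_μ(‖Du‖)` be the centred Hardy–Littlewood maximal function of the
size `‖Du‖` (`Literature.Analysis.SingularIntegrals.maximalFunction`). Proved here:

* `lintegral_enorm_sub_average_ball_le` — Poincaré on balls,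
  `∫_B ‖u - u_B‖ ≤ 2ⁿ⁺¹ r ∫_B ‖Du‖`, `B = B(z, r)` (from the tree's two-point estimate
  `Literature.Analysis.FunctionSpaces.lintegral_prod_enorm_sub_rpow_le_of_contDiff`);
* `enorm_sub_average_le_maximal` — `‖u(x) - u_{B(x,r)}‖ ≤ 2²ⁿ⁺² r M(x)` (telescoping over
  the dyadic balls `B(x, 2⁻ᵏr)` and Poincaré on each);
* `enorm_sub_le_maximal` — `‖u(x) - u(y)‖ ≤ 2²ⁿ⁺⁵ ‖x - y‖ (M(x) + M(y))`;
* `lipschitzOnWith_of_maximal_le` — on `{M ≤ λ}` the function `u` is `2²ⁿ⁺⁶λ`-Lipschitz.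

This is the standard input of the Lipschitz truncation / Calderón–Zygmund decomposition of
Sobolev functions [Badr2009, §5 proof of Prop. 5.6 (the function `g` is Lipschitz with
`|∇g| ≤ Cα` off the bad set)]; here for smooth `u`, with explicit (immaterial) constants.

## References

* [Badr2009] N. Badr, *Real interpolation of Sobolev spaces*, Math. Scand. 105 (2009), §3–§5
  (Calderón–Zygmund lemma for Sobolev functions, Prop. 3.5 / Prop. 5.6).
* [Stein1971] E. M. Stein, *Singular integrals and differentiability properties of functions*
  (1970), Ch. I §1 (maximal function).
-/

noncomputable section

open MeasureTheory Metric Set Filter Topology Module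
open scoped ENNReal NNReal

namespace Literature.Analysis.FunctionSpaces

open Literature.Analysis.SingularIntegrals

universe u

variable {E : Type u} [NormedAddCommGroup E] [NormedSpace ℝ E] [FiniteDimensional ℝ E]
  [MeasurableSpace E] [BorelSpace E] (μ : Measure E) [μ.IsAddHaarMeasure]
  {F : Type*} [NormedAddCommGroup F] [NormedSpace ℝ F] [CompleteSpace F]

/-! ### Poincaré on balls -/

/-- **Poincaré on balls for `C¹` maps**: `∫_B ‖u - u_B‖ ≤ 2ⁿ⁺¹ r ∫_B ‖Du‖`, `B = B(z, r)`,
`u_B = ⨍_B u` (two-point estimate of the tree with `A = B`, `d = 2r`, `q = 1`).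
[cite: Badr2009, §3 (P_q) with q = 1 on ℝⁿ] -/
theorem lintegral_enorm_sub_average_ball_le {u : E → F} (hu : ContDiff ℝ 1 u) (z : E) {r : ℝ}
    (hr : 0 < r) :
    ∫⁻ x in ball z r, ‖u x - ⨍ y in ball z r, u y ∂μ‖ₑ ∂μ ≤
      2 ^ (finrank ℝ E + 1) * ENNReal.ofReal r * ∫⁻ w in ball z r, ‖fderiv ℝ u w‖ₑ ∂μ := by
  set B := ball z r with hB
  have hB0 : μ B ≠ 0 := (measure_ball_pos μ z hr).ne'
  have hBt : μ B ≠ ⊤ := measure_ball_lt_top.ne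
  have hint : IntegrableOn u B μ :=
    (hu.continuous.continuousOn.integrableOn_compact (isCompact_closedBall z r)).mono_set
      ball_subset_closedBall
  -- the two-point estimate with `q = 1`
  have hseg : ∀ x ∈ B, ∀ y ∈ B, segment ℝ x y ⊆ B := fun x hx y hy =>
    (convex_ball z r).segment_subset hx hy
  have hd : ∀ x ∈ B, ∀ y ∈ B, ‖y - x‖ ≤ 2 * r := fun x hx y hy => by
    calc ‖y - x‖ ≤ ‖y - z‖ + ‖z - x‖ := norm_sub_le_norm_sub_add_norm_sub _ _ _
      _ ≤ r + r := add_le_add (le_of_lt (mem_ball_iff_norm.1 hy))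
          (le_of_lt (by rw [← dist_eq_norm, dist_comm]; exact hx))
      _ = 2 * r := by ring
  have h2 := lintegral_prod_enorm_sub_rpow_le_of_contDiff (μ := μ) hu measurableSet_ball
    measurableSet_ball subset_rfl hseg hd le_rfl
  simp only [ENNReal.rpow_one] at h2
  have hmeas : AEMeasurable (fun p : E × E => ‖u p.1 - u p.2‖ₑ)
      ((μ.restrict B).prod (μ.restrict B)) :=
    ((hu.continuous.comp continuous_fst).sub
      (hu.continuous.comp continuous_snd)).enorm.measurable.aemeasurable
  have hprod : ∫⁻ x in B, ∫⁻ y in B, ‖u x - u y‖ₑ ∂μ ∂μ =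
      ∫⁻ p, ‖u p.1 - u p.2‖ₑ ∂((μ.restrict B).prod (μ.restrict B)) :=
    (lintegral_prod _ hmeas).symm
  calc ∫⁻ x in B, ‖u x - ⨍ y in B, u y ∂μ‖ₑ ∂μ
      ≤ ∫⁻ x in B, (μ B)⁻¹ * ∫⁻ y in B, ‖u x - u y‖ₑ ∂μ ∂μ :=
        setLIntegral_mono' measurableSet_ball fun x _ => enorm_sub_setAverage_le hB0 hBt hint (u x)
    _ = (μ B)⁻¹ * ∫⁻ p, ‖u p.1 - u p.2‖ₑ ∂((μ.restrict B).prod (μ.restrict B)) := by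
        rw [lintegral_const_mul' _ _ (ENNReal.inv_ne_top.2 hB0), hprod]
    _ ≤ (μ B)⁻¹ * (ENNReal.ofReal (2 * r) * 2 ^ finrank ℝ E * μ B *
          ∫⁻ w in B, ‖fderiv ℝ u w‖ₑ ∂μ) := mul_le_mul_right h2 _
    _ = 2 ^ (finrank ℝ E + 1) * ENNReal.ofReal r * ∫⁻ w in B, ‖fderiv ℝ u w‖ₑ ∂μ := by
        rw [ENNReal.ofReal_mul zero_le_two, ENNReal.ofReal_ofNat, pow_succ,
          show (μ B)⁻¹ * (2 * ENNReal.ofReal r * 2 ^ finrank ℝ E * μ B *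
            ∫⁻ w in B, ‖fderiv ℝ u w‖ₑ ∂μ) = ((μ B)⁻¹ * μ B) *
            (2 ^ finrank ℝ E * 2 * ENNReal.ofReal r * ∫⁻ w in B, ‖fderiv ℝ u w‖ₑ ∂μ) by ring,
          ENNReal.inv_mul_cancel hB0 hBt, one_mul]

/-! ### Comparing averages over nested balls -/

/-- `‖u_{B'} - u_B‖ ≤ μ(B')⁻¹ ∫_B ‖u - u_B‖` for measurable `B' ⊆ B` of positive finite measure.
[folklore] -/
theorem enorm_average_sub_average_le {X : Type*} [MeasurableSpace X] {μ : Measure X}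
    {u : X → F} {B B' : Set X} (hB'B : B' ⊆ B)
    (hint : IntegrableOn u B μ) (hB'0 : μ B' ≠ 0) (hBt : μ B ≠ ⊤) :
    ‖(⨍ y in B', u y ∂μ) - ⨍ y in B, u y ∂μ‖ₑ ≤
      (μ B')⁻¹ * ∫⁻ x in B, ‖u x - ⨍ y in B, u y ∂μ‖ₑ ∂μ := by
  have hB't : μ B' ≠ ⊤ := measure_ne_top_of_subset hB'B hBt
  have hint' : IntegrableOn u B' μ := hint.mono_set hB'B
  have h := enorm_sub_setAverage_le hB'0 hB't hint' (⨍ y in B, u y ∂μ)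
  rw [enorm_sub_rev] at h
  refine h.trans (mul_le_mul_right ?_ _)
  calc ∫⁻ y in B', ‖(⨍ y in B, u y ∂μ) - u y‖ₑ ∂μ = ∫⁻ y in B', ‖u y - ⨍ y in B, u y ∂μ‖ₑ ∂μ := by
        simp only [enorm_sub_rev]
    _ ≤ ∫⁻ y in B, ‖u y - ⨍ y in B, u y ∂μ‖ₑ ∂μ := lintegral_mono_set hB'B

/-- **One dyadic step**: `‖u_{B(x, r/2)} - u_{B(x,r)}‖ ≤ 2²ⁿ⁺¹ r M(x)`, `M = M(‖Du‖)`.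
[cite: Badr2009, §5 proof of Prop. 5.6] -/
theorem enorm_average_half_sub_average_le {u : E → F} (hu : ContDiff ℝ 1 u) (x : E) {r : ℝ}
    (hr : 0 < r) :
    ‖(⨍ y in ball x (r / 2), u y ∂μ) - ⨍ y in ball x r, u y ∂μ‖ₑ ≤
      2 ^ (2 * finrank ℝ E + 1) * ENNReal.ofReal r *
        maximalFunction μ (fun w => ‖fderiv ℝ u w‖ₑ) x := by
  set n := finrank ℝ E with hn
  have hr2 : 0 < r / 2 := half_pos hr
  have hsub : ball x (r / 2) ⊆ ball x r := ball_subset_ball (by linarith)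
  have hB0 : μ (ball x r) ≠ 0 := (measure_ball_pos μ x hr).ne'
  have hBt : μ (ball x r) ≠ ⊤ := measure_ball_lt_top.ne
  have hB'0 : μ (ball x (r / 2)) ≠ 0 := (measure_ball_pos μ x hr2).ne'
  have hint : IntegrableOn u (ball x r) μ :=
    (hu.continuous.continuousOn.integrableOn_compact (isCompact_closedBall x r)).mono_set
      ball_subset_closedBall
  -- `μ(B(x,r)) = 2ⁿ μ(B(x,r/2))`
  have hscale : μ (ball x r) = 2 ^ n * μ (ball x (r / 2)) := by
    have := measure_ball_mul_eq μ x x (c := 2) two_pos (r / 2)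
    rw [show (2 : ℝ) * (r / 2) = r by ring, ENNReal.ofReal_pow (by norm_num),
      ENNReal.ofReal_ofNat] at this
    exact this
  have hinv : (μ (ball x (r / 2)))⁻¹ = 2 ^ n * (μ (ball x r))⁻¹ := by
    rw [hscale, ENNReal.mul_inv (Or.inl (by simp)) (Or.inl (by simp)), ← mul_assoc,
      ENNReal.mul_inv_cancel (by simp) (by simp), one_mul]
  calc ‖(⨍ y in ball x (r / 2), u y ∂μ) - ⨍ y in ball x r, u y ∂μ‖ₑ
      ≤ (μ (ball x (r / 2)))⁻¹ * ∫⁻ w in ball x r, ‖u w - ⨍ y in ball x r, u y ∂μ‖ₑ ∂μ :=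
        enorm_average_sub_average_le hsub hint hB'0 hBt
    _ ≤ (μ (ball x (r / 2)))⁻¹ * (2 ^ (n + 1) * ENNReal.ofReal r *
          ∫⁻ w in ball x r, ‖fderiv ℝ u w‖ₑ ∂μ) :=
        mul_le_mul_right (lintegral_enorm_sub_average_ball_le μ hu x hr) _
    _ = 2 ^ (2 * n + 1) * ENNReal.ofReal r *
          ((μ (ball x r))⁻¹ * ∫⁻ w in ball x r, ‖fderiv ℝ u w‖ₑ ∂μ) := by
        rw [hinv]; ring
    _ ≤ 2 ^ (2 * n + 1) * ENNReal.ofReal r * maximalFunction μ (fun w => ‖fderiv ℝ u w‖ₑ) x :=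
        mul_le_mul_right (average_le_maximalFunction μ _ x hr) _

/-! ### Telescoping: `‖u(x) - u_{B(x,r)}‖ ≤ 2²ⁿ⁺² r M(x)` -/

/-- Averages of a continuous function over shrinking balls tend to its value:
`‖u(x) - u_{B(x,ρ)}‖ ≤ δ` once `‖u(y) - u(x)‖ ≤ δ` on `B(x, ρ)`. [folklore] -/
theorem enorm_sub_average_le_of_forall_le {u : E → F} (hu : Continuous u) (x : E) {ρ : ℝ}
    (hρ : 0 < ρ) {δ : ℝ≥0∞} (hδ : ∀ y ∈ ball x ρ, ‖u x - u y‖ₑ ≤ δ) :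
    ‖u x - ⨍ y in ball x ρ, u y ∂μ‖ₑ ≤ δ := by
  have hB0 : μ (ball x ρ) ≠ 0 := (measure_ball_pos μ x hρ).ne'
  have hBt : μ (ball x ρ) ≠ ⊤ := measure_ball_lt_top.ne
  have hint : IntegrableOn u (ball x ρ) μ :=
    (hu.continuousOn.integrableOn_compact (isCompact_closedBall x ρ)).mono_set
      ball_subset_closedBall
  calc ‖u x - ⨍ y in ball x ρ, u y ∂μ‖ₑ
      ≤ (μ (ball x ρ))⁻¹ * ∫⁻ y in ball x ρ, ‖u x - u y‖ₑ ∂μ :=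
        enorm_sub_setAverage_le hB0 hBt hint (u x)
    _ ≤ (μ (ball x ρ))⁻¹ * ∫⁻ _y in ball x ρ, δ ∂μ :=
        mul_le_mul_right (setLIntegral_mono' measurableSet_ball hδ) _
    _ = δ := by
        rw [setLIntegral_const, mul_comm δ, ← mul_assoc, ENNReal.inv_mul_cancel hB0 hBt, one_mul]

/-- **`‖u(x) - u_{B(x,r)}‖ ≤ 2²ⁿ⁺² r M(‖Du‖)(x)`** for `C¹` maps (telescoping over the dyadic
balls `B(x, 2⁻ᵏ r)`, one Poincaré step each, and continuity at the centre).
[cite: Badr2009, §5 proof of Prop. 5.6] -/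
theorem enorm_sub_average_le_maximal {u : E → F} (hu : ContDiff ℝ 1 u) (x : E) {r : ℝ}
    (hr : 0 < r) :
    ‖u x - ⨍ y in ball x r, u y ∂μ‖ₑ ≤
      2 ^ (2 * finrank ℝ E + 2) * ENNReal.ofReal r *
        maximalFunction μ (fun w => ‖fderiv ℝ u w‖ₑ) x := by
  set n := finrank ℝ E with hn
  set Mx := maximalFunction μ (fun w => ‖fderiv ℝ u w‖ₑ) x with hMx
  -- dyadic radii and averages
  set ρ : ℕ → ℝ := fun k => r / 2 ^ k with hρ
  set A : ℕ → F := fun k => ⨍ y in ball x (ρ k), u y ∂μ with hA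
  have hρpos : ∀ k, 0 < ρ k := fun k => by positivity
  have hρsucc : ∀ k, ρ (k + 1) = ρ k / 2 := fun k => by
    simp only [hρ, pow_succ]; field_simp
  -- each step
  have hstep : ∀ k, ‖A (k + 1) - A k‖ₑ ≤ 2 ^ (2 * n + 1) * ENNReal.ofReal (ρ k) * Mx := by
    intro k
    simp only [hA]
    rw [hρsucc]
    exact enorm_average_half_sub_average_le μ hu x (hρpos k)
  -- the partial telescoping sums
  have htel : ∀ K, ‖u x - A 0‖ₑ ≤ ‖u x - A K‖ₑ + ∑ k ∈ Finset.range K, ‖A (k + 1) - A k‖ₑ := by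
    intro K
    induction K with
    | zero => simp
    | succ K ih =>
      calc ‖u x - A 0‖ₑ ≤ ‖u x - A K‖ₑ + ∑ k ∈ Finset.range K, ‖A (k + 1) - A k‖ₑ := ih
        _ ≤ (‖u x - A (K + 1)‖ₑ + ‖A (K + 1) - A K‖ₑ) +
              ∑ k ∈ Finset.range K, ‖A (k + 1) - A k‖ₑ := by
            gcongr
            calc ‖u x - A K‖ₑ = ‖(u x - A (K + 1)) + (A (K + 1) - A K)‖ₑ := by
                  congr 1; abel
              _ ≤ ‖u x - A (K + 1)‖ₑ + ‖A (K + 1) - A K‖ₑ := enorm_add_le _ _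
        _ = ‖u x - A (K + 1)‖ₑ + ∑ k ∈ Finset.range (K + 1), ‖A (k + 1) - A k‖ₑ := by
            rw [Finset.sum_range_succ]; ring
  -- `Σ_{k<K} ρ_k ≤ 2r`
  have hsumρ : ∀ K, ∑ k ∈ Finset.range K, ρ k ≤ 2 * r := fun K => by
    have h1 : ∀ k, ρ k = r * (1 / 2) ^ k := fun k => by
      simp only [hρ, div_eq_mul_inv, one_mul, inv_pow]
    simp_rw [h1, ← Finset.mul_sum]
    rw [mul_comm]
    exact mul_le_mul_of_nonneg_right (sum_geometric_two_le K) hr.le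
  -- the geometric sum of the steps
  have hgeom : ∀ K, ∑ k ∈ Finset.range K, ‖A (k + 1) - A k‖ₑ ≤
      2 ^ (2 * n + 2) * ENNReal.ofReal r * Mx := by
    intro K
    calc ∑ k ∈ Finset.range K, ‖A (k + 1) - A k‖ₑ
        ≤ ∑ k ∈ Finset.range K, 2 ^ (2 * n + 1) * ENNReal.ofReal (ρ k) * Mx :=
          Finset.sum_le_sum fun k _ => hstep k
      _ = 2 ^ (2 * n + 1) * Mx * ∑ k ∈ Finset.range K, ENNReal.ofReal (ρ k) := by
          rw [Finset.mul_sum]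
          refine Finset.sum_congr rfl fun k _ => by ring
      _ ≤ 2 ^ (2 * n + 1) * Mx * ENNReal.ofReal (2 * r) := by
          refine mul_le_mul_right ?_ _
          rw [← ENNReal.ofReal_sum_of_nonneg fun k _ => (hρpos k).le]
          exact ENNReal.ofReal_le_ofReal (hsumρ K)
      _ = 2 ^ (2 * n + 2) * ENNReal.ofReal r * Mx := by
          rw [ENNReal.ofReal_mul zero_le_two, ENNReal.ofReal_ofNat, pow_succ]; ring
  -- continuity at the centre: the remainder is small
  refine ENNReal.le_of_forall_pos_le_add fun δ hδ _ => ?_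
  have hcont := Metric.continuousAt_iff.1 (hu.continuous.continuousAt (x := x))
  obtain ⟨η, hη, hηδ⟩ := hcont δ (NNReal.coe_pos.2 hδ)
  obtain ⟨K, hK⟩ : ∃ K : ℕ, ρ K < η := by
    obtain ⟨K, hK⟩ := exists_pow_lt_of_lt_one (div_pos hη hr) (by norm_num : (1 / 2 : ℝ) < 1)
    refine ⟨K, ?_⟩
    have h1 : ρ K = r * (1 / 2) ^ K := by
      simp only [hρ, div_eq_mul_inv, one_mul, inv_pow]
    rw [h1]
    calc r * (1 / 2) ^ K < r * (η / r) := mul_lt_mul_of_pos_left hK hr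
      _ = η := mul_div_cancel₀ η hr.ne'
  have hsmall : ‖u x - A K‖ₑ ≤ δ := by
    refine enorm_sub_average_le_of_forall_le μ hu.continuous x (hρpos K) fun y hy => ?_
    have hyx : dist y x < η := (mem_ball.1 hy).trans hK
    have := hηδ hyx
    rw [← edist_eq_enorm_sub, edist_comm, edist_dist]
    calc ENNReal.ofReal (dist (u y) (u x)) ≤ ENNReal.ofReal δ := ENNReal.ofReal_le_ofReal this.le
      _ = δ := ENNReal.ofReal_coe_nnreal
  have hA0 : A 0 = ⨍ y in ball x r, u y ∂μ := by
    simp only [hA, hρ, pow_zero, div_one]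
  rw [← hA0]
  calc ‖u x - A 0‖ₑ ≤ ‖u x - A K‖ₑ + ∑ k ∈ Finset.range K, ‖A (k + 1) - A k‖ₑ := htel K
    _ ≤ δ + 2 ^ (2 * n + 2) * ENNReal.ofReal r * Mx := add_le_add hsmall (hgeom K)
    _ = 2 ^ (2 * n + 2) * ENNReal.ofReal r * Mx + δ := add_comm _ _

/-! ### The two-point estimate and the Lipschitz property on `{M ≤ λ}` -/

/-- The middle term: `‖u_{B(x,2ρ)} - u_{B(y,4ρ)}‖ ≤ 2²ⁿ⁺³ ρ M(y)` when `‖x - y‖ ≤ ρ`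
(`B(x,2ρ) ⊆ B(y,4ρ)`, `μ B(y,4ρ) = 2ⁿ μ B(x,2ρ)`, Poincaré on `B(y, 4ρ)`). [folklore] -/
theorem enorm_average_sub_average_le_maximal {u : E → F} (hu : ContDiff ℝ 1 u) {x y : E} {ρ : ℝ}
    (hρ : 0 < ρ) (hxy : ‖x - y‖ ≤ ρ) :
    ‖(⨍ w in ball x (2 * ρ), u w ∂μ) - ⨍ w in ball y (4 * ρ), u w ∂μ‖ₑ ≤
      2 ^ (2 * finrank ℝ E + 3) * ENNReal.ofReal ρ *
        maximalFunction μ (fun w => ‖fderiv ℝ u w‖ₑ) y := by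
  set n := finrank ℝ E with hn
  have h4 : 0 < 4 * ρ := by positivity
  have h2 : 0 < 2 * ρ := by positivity
  have hsub : ball x (2 * ρ) ⊆ ball y (4 * ρ) := by
    intro w hw
    rw [mem_ball, dist_eq_norm] at hw ⊢
    calc ‖w - y‖ ≤ ‖w - x‖ + ‖x - y‖ := norm_sub_le_norm_sub_add_norm_sub _ _ _
      _ < 2 * ρ + ρ := add_lt_add_of_lt_of_le hw hxy
      _ ≤ 4 * ρ := by linarith
  have hB0 : μ (ball y (4 * ρ)) ≠ 0 := (measure_ball_pos μ y h4).ne'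
  have hBt : μ (ball y (4 * ρ)) ≠ ⊤ := measure_ball_lt_top.ne
  have hB'0 : μ (ball x (2 * ρ)) ≠ 0 := (measure_ball_pos μ x h2).ne'
  have hint : IntegrableOn u (ball y (4 * ρ)) μ :=
    (hu.continuous.continuousOn.integrableOn_compact (isCompact_closedBall y (4 * ρ))).mono_set
      ball_subset_closedBall
  have hscale : μ (ball y (4 * ρ)) = 2 ^ n * μ (ball x (2 * ρ)) := by
    have := measure_ball_mul_eq μ x y (c := 2) two_pos (2 * ρ)
    rw [show (2 : ℝ) * (2 * ρ) = 4 * ρ by ring, ENNReal.ofReal_pow (by norm_num),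
      ENNReal.ofReal_ofNat] at this
    exact this
  have hinv : (μ (ball x (2 * ρ)))⁻¹ = 2 ^ n * (μ (ball y (4 * ρ)))⁻¹ := by
    rw [hscale, ENNReal.mul_inv (Or.inl (by simp)) (Or.inl (by simp)), ← mul_assoc,
      ENNReal.mul_inv_cancel (by simp) (by simp), one_mul]
  calc ‖(⨍ w in ball x (2 * ρ), u w ∂μ) - ⨍ w in ball y (4 * ρ), u w ∂μ‖ₑ
      ≤ (μ (ball x (2 * ρ)))⁻¹ *
          ∫⁻ w in ball y (4 * ρ), ‖u w - ⨍ w in ball y (4 * ρ), u w ∂μ‖ₑ ∂μ :=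
        enorm_average_sub_average_le hsub hint hB'0 hBt
    _ ≤ (μ (ball x (2 * ρ)))⁻¹ * (2 ^ (n + 1) * ENNReal.ofReal (4 * ρ) *
          ∫⁻ w in ball y (4 * ρ), ‖fderiv ℝ u w‖ₑ ∂μ) :=
        mul_le_mul_right (lintegral_enorm_sub_average_ball_le μ hu y h4) _
    _ = 2 ^ (2 * n + 3) * ENNReal.ofReal ρ *
          ((μ (ball y (4 * ρ)))⁻¹ * ∫⁻ w in ball y (4 * ρ), ‖fderiv ℝ u w‖ₑ ∂μ) := by
        rw [hinv, ENNReal.ofReal_mul (by norm_num), show (4 : ℝ) = 2 ^ 2 by norm_num,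
          ENNReal.ofReal_pow (by norm_num), ENNReal.ofReal_ofNat]
        ring
    _ ≤ 2 ^ (2 * n + 3) * ENNReal.ofReal ρ * maximalFunction μ (fun w => ‖fderiv ℝ u w‖ₑ) y :=
        mul_le_mul_right (average_le_maximalFunction μ _ y h4) _

/-- **The pointwise maximal-function estimate**:
`‖u(x) - u(y)‖ ≤ 2²ⁿ⁺⁵ ‖x - y‖ (M(x) + M(y))`, `M = M(‖Du‖)`, for `C¹` maps `u`.
[cite: Badr2009, §5 proof of Prop. 5.6] -/
theorem enorm_sub_le_maximal {u : E → F} (hu : ContDiff ℝ 1 u) (x y : E) :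
    ‖u x - u y‖ₑ ≤ 2 ^ (2 * finrank ℝ E + 5) * ENNReal.ofReal ‖x - y‖ *
      (maximalFunction μ (fun w => ‖fderiv ℝ u w‖ₑ) x +
        maximalFunction μ (fun w => ‖fderiv ℝ u w‖ₑ) y) := by
  set n := finrank ℝ E with hn
  set M := maximalFunction μ (fun w => ‖fderiv ℝ u w‖ₑ) with hM
  rcases eq_or_ne x y with rfl | hxy
  · simp
  set ρ := ‖x - y‖ with hρdef
  have hρ : 0 < ρ := norm_pos_iff.2 (sub_ne_zero.2 hxy)
  have h2 : 0 < 2 * ρ := by positivity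
  have h4 : 0 < 4 * ρ := by positivity
  -- three pieces
  have hA := enorm_sub_average_le_maximal μ hu x h2
  have hB := enorm_average_sub_average_le_maximal μ hu hρ le_rfl
  have hC := enorm_sub_average_le_maximal μ hu y h4
  calc ‖u x - u y‖ₑ
      = ‖(u x - ⨍ w in ball x (2 * ρ), u w ∂μ) +
          ((⨍ w in ball x (2 * ρ), u w ∂μ) - ⨍ w in ball y (4 * ρ), u w ∂μ) -
          (u y - ⨍ w in ball y (4 * ρ), u w ∂μ)‖ₑ := by congr 1; abel
    _ ≤ ‖u x - ⨍ w in ball x (2 * ρ), u w ∂μ‖ₑ +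
          ‖(⨍ w in ball x (2 * ρ), u w ∂μ) - ⨍ w in ball y (4 * ρ), u w ∂μ‖ₑ +
          ‖u y - ⨍ w in ball y (4 * ρ), u w ∂μ‖ₑ :=
        enorm_sub_le.trans (add_le_add (enorm_add_le _ _) le_rfl)
    _ ≤ 2 ^ (2 * n + 2) * ENNReal.ofReal (2 * ρ) * M x +
          2 ^ (2 * n + 3) * ENNReal.ofReal ρ * M y +
          2 ^ (2 * n + 2) * ENNReal.ofReal (4 * ρ) * M y := add_le_add (add_le_add hA hB) hC
    _ = 2 ^ (2 * n + 3) * ENNReal.ofReal ρ * M x +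
          (2 ^ (2 * n + 3) + 2 ^ (2 * n + 4)) * ENNReal.ofReal ρ * M y := by
        rw [ENNReal.ofReal_mul (by norm_num), ENNReal.ofReal_mul (by norm_num),
          show (4 : ℝ) = 2 ^ 2 by norm_num, ENNReal.ofReal_pow (by norm_num), ENNReal.ofReal_ofNat]
        ring
    _ ≤ 2 ^ (2 * n + 5) * ENNReal.ofReal ρ * M x + 2 ^ (2 * n + 5) * ENNReal.ofReal ρ * M y := by
        have e1 : (2 : ℝ≥0∞) ^ (2 * n + 3) ≤ 2 ^ (2 * n + 5) :=
          pow_le_pow_right₀ one_le_two (by omega)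
        have e2 : (2 : ℝ≥0∞) ^ (2 * n + 3) + 2 ^ (2 * n + 4) ≤ 2 ^ (2 * n + 5) := by
          calc (2 : ℝ≥0∞) ^ (2 * n + 3) + 2 ^ (2 * n + 4)
              ≤ 2 ^ (2 * n + 3) + 2 ^ (2 * n + 4) + 2 ^ (2 * n + 3) := le_self_add
            _ = 2 ^ (2 * n + 5) := by ring
        gcongr
    _ = 2 ^ (2 * n + 5) * ENNReal.ofReal ‖x - y‖ * (M x + M y) := by rw [hρdef]; ring

/-- **Lipschitz on the sublevel sets of the maximal function**: on `{M(‖Du‖) ≤ λ}` a `C¹`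
map is `2²ⁿ⁺⁶λ`-Lipschitz. [cite: Badr2009, §5 proof of Prop. 5.6] -/
theorem lipschitzOnWith_of_maximal_le {u : E → F} (hu : ContDiff ℝ 1 u) (l : ℝ≥0) :
    LipschitzOnWith (2 ^ (2 * finrank ℝ E + 6) * l) u
      {x | maximalFunction μ (fun w => ‖fderiv ℝ u w‖ₑ) x ≤ l} := by
  intro x hx y hy
  rw [mem_setOf_eq] at hx hy
  rw [edist_eq_enorm_sub, edist_dist, dist_eq_norm]
  calc ‖u x - u y‖ₑ
      ≤ 2 ^ (2 * finrank ℝ E + 5) * ENNReal.ofReal ‖x - y‖ *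
          (maximalFunction μ (fun w => ‖fderiv ℝ u w‖ₑ) x +
            maximalFunction μ (fun w => ‖fderiv ℝ u w‖ₑ) y) := enorm_sub_le_maximal μ hu x y
    _ ≤ 2 ^ (2 * finrank ℝ E + 5) * ENNReal.ofReal ‖x - y‖ * ((l : ℝ≥0∞) + l) := by gcongr
    _ = ((2 ^ (2 * finrank ℝ E + 6) * l : ℝ≥0) : ℝ≥0∞) * ENNReal.ofReal ‖x - y‖ := by
        push_cast
        ring

end Literature.Analysis.FunctionSpaces

end
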